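import Summits.FinalStateConjecture.FinalStateConjecture.Theses.EIHFluxBalance
import Summits.FinalStateConjecture.FinalStateConjecture.Theorems.WeakCosmicCensorshipTame.Negative.LoadBearing
import Literature.Geometry.Lorentzian.TameGenericityDiagonal
import Literature.Geometry.Lorentzian.TrivialDataAdmissible

/-!
# `ModulatedKerrHandoff` H′ (crux `stmt-FinalStateConjecture-17402`, route EIHFluxBalance, rank 3) —
# negative-side lemmas I: H′ refines tame censorship; the load-bearing hypotheses transfer to EVERY
# refinement of the censored property; receding-only witness families are not immersed

Refuter seat `refuter-cdisprove-stmt-FinalStateConjecture-17402-0` (standing disprover of the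
re-typed crux H′ = `EIHFluxBalance.ModulatedKerrHandoff`, rev 6; cycle 1, 2026-08-17; workfile
`Cruxes/ModulatedKerrHandoff/Disproof.lean`). Kernel-checked NEGATIVE-SIDE lemmas (cdisprove protocol
(a)–(c)), `sorry`-free, no definitions, no named facts; nothing here closes the item.

H′ is, `Σ` by `Σ`, TAME Christodoulou-genericity (`IsTameChristodoulouGeneric … 1`) inside
`admissibleVacuumData Σ` of the property "an MGHD exists ∧ every MGHD has complete `𝓘⁺` ∧ carries the
sixteen-clause modulated multi-Kerr–Schild ansatz with handoff". That property REFINES the censored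
property `C D := (∃ MGHD) ∧ ∀ MGHD, complete 𝓘⁺` of the sibling cruxes `WeakCosmicCensorshipMGHD`
(9952) / `WeakCosmicCensorshipTame` (17269), and tame genericity is monotone in the property and
forgets to plain genericity; so the load-bearing analysis of those cruxes applies to H′ — and, stated
once and for all below, to EVERY property `P` that needs a vacuum Cauchy development (`P D` ⇒
`Nonempty (VacuumCauchyDevelopment D)`), in particular to every future restatement of H′ that keeps the
guard `∃ 𝒟, 𝒟.IsMaximal`.

* §1 TRANSFER LEMMAS (general `P`): `not_isTameGeneric_noConstraint_of_needsDevelopment` — over the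
  constraint-free class `admissibleNoConstraint ℝ³` NO property needing a development is tame-generic
  (the trapped datum `bumpData`: Hamiltonian constraint `6` at the origin, continuous along jointly
  smooth curves); `not_isTameGeneric_of_not_t2Space` — on a non-Hausdorff `Σ` carrying an admissible
  datum no such property is tame-generic (no data embedding into a Hausdorff spacetime);
  `trivialData_exceptional_forallDev`, `not_isTameGeneric_forallDev_of` — with `IsMaximal` dropped
  from the `∀`-clause the trivial datum is exceptional for EVERY post-development demand `Q` (the
  time-truncated Minkowski space has incomplete `𝓘⁺`), and modulo "every admissible datum on `ℝ³` has
  SOME development with incomplete `𝓘⁺`" no such property is tame-generic.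
* §2 BY NAME FOR H′: `isTameGeneric_censored_of_modulatedKerrHandoff` (H′ ⇒ tame typed weak cosmic
  censorship `Σ` by `Σ`: a kill there kills H′), `not_modulatedKerrHandoff_of_forall_not_censored` and
  `not_modulatedKerrHandoff_of_forall_not_isMaximal` (the two MGHD-level roads to `¬H′` on `ℝ³`),
  `exists_isMaximal_of_modulatedKerrHandoff` (H′ produces an MGHD of an admissible datum on `ℝ³` with
  complete `𝓘⁺`: Choquet-Bruhat–Geroch existence and censorship are load-bearing, no proof by
  bookkeeping — no maximal development of any datum is constructed in the tree).
* §3 THE WITNESS NOTION: `not_isImmersedAtZero_of_eventuallyEq` — a family whose members agree with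
  the base datum point by point for all small parameters (every RECEDING-ONLY modification: tail
  trimming / Kerr-end gluing at radius `R(c) → ∞`, far-out pulses — the device that swallowed the tail
  strata of the retired crux 10167) is NOT immersed at `0`, hence not a witness for H′: every tame
  witness must move the datum at first order somewhere at `c = 0`. (Burial, `M(c) → ∞`, is excluded by
  tameness: `WeakCosmicCensorshipTame/Negative/TameMassContinuity.lean`.)

The read-back of H′ (`HandoffN`, `HandoffProp`, `modulatedKerrHandoff_iff` by `Iff.rfl`) and the
instances of §1 at the crux's own property are filed separately (`Negative/Readback.lean`).

## References

* D. Christodoulou, CQG 16 (1999) A23, p. A24 (admissible class; positive codimension; lines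
  `α₀ + c f` in a fixed space) and p. A27 (complete `𝓘⁺`).
* Y. Choquet-Bruhat, R. Geroch, CMP 14 (1969) 329, p. 330 (maximal developments).
* Y. Choquet-Bruhat, *General Relativity and the Einstein Equations* (2009), Ch. VI, Thm. 3.3.
-/

noncomputable section

-- the doubled `FinalStateConjecture.FinalStateConjecture` path component trips dupNamespace
set_option linter.dupNamespace false

open Bundle TopologicalSpace Set Function Filter
open scoped Manifold ContDiff Topology

namespace Summit.FinalStateConjecture.FinalStateConjecture.Theorems.ModulatedKerrHandoff.Negative

open Literature.Geometry.Lorentzian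
open Literature.Geometry.Lorentzian.InitialDataSet
  (IsTameDataFamily IsImmersedAtZero IsTameChristodoulouGeneric IsSmoothDataFamily)
open Summit.FinalStateConjecture.FinalStateConjecture.Theses.EIHFluxBalance (ModulatedKerrHandoff)
open Summit.FinalStateConjecture.FinalStateConjecture.Theorems.WeakCosmicCensorshipMGHD.Negative
  (admissibleNoConstraint bumpData bumpData_mem_admissibleNoConstraint
    isEmpty_vacuumCauchyDevelopment_bumpData exists_ne_zero_isEmpty_vacuumCauchyDevelopment
    isEmpty_vacuumCauchyDevelopment_of_not_t2Space
    exists_vacuumCauchyDevelopment_trivialData_not_complete)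
open Summit.FinalStateConjecture.FinalStateConjecture.Theorems.WeakCosmicCensorshipTame.Negative
  (not_isTameGeneric_of_forall_not)

/-! ## §1 Transfer lemmas: every property that needs a development inherits the load-bearing analysis -/

/-- **Over the constraint-free class no property that needs a development is tame-generic.** Let `P`
be a property of data on `ℝ³` such that `P D` forces `D` to have a vacuum Cauchy development (every
refinement of "an MGHD exists", e.g. the property of H′). Then `P` is NOT tame-Christodoulou-generic in
`admissibleNoConstraint ℝ³` (`admissibleVacuumData` with `IsVacuumConstraintSolution` deleted): the
complete AF datum `bumpData = (ℝ³, δ, ψ(|y|²)δ)` is in the class, has no development (Hamiltonian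
constraint `6 ≠ 0` at the origin), and TRAPS every jointly smooth curve through it — the constraint
function at the origin is continuous in the parameter, so members at small nonzero parameters have no
development either (`exists_ne_zero_isEmpty_vacuumCauchyDevelopment`); a fortiori every tame curve.
So the vacuum-constraint clause of admissibility is load-bearing for H′ and for every restatement of
it keeping the MGHD guard. [cite: Christodoulou1999, p. A24] [cite: ChoquetBruhat2009, Ch. VI, Thm. 3.3] -/
theorem not_isTameGeneric_noConstraint_of_needsDevelopment
    {P : InitialDataSet (𝓡 3) Minkowski.slice → Prop}
    (hP : ∀ D, P D → Nonempty (VacuumCauchyDevelopment D)) :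
    ¬ IsTameChristodoulouGeneric (admissibleNoConstraint Minkowski.slice) P 1 := by
  intro hW
  have hexc0 : ¬ P bumpData := fun h0 ↦
    isEmpty_vacuumCauchyDevelopment_bumpData.false (hP _ h0).some
  obtain ⟨e, F, hF, -, h0, -, hadm, hexc⟩ := hW bumpData ⟨bumpData_mem_admissibleNoConstraint, hexc0⟩
  obtain ⟨c, hc, hempty⟩ := exists_ne_zero_isEmpty_vacuumCauchyDevelopment hF.1 h0
  exact hexc c hc ⟨hadm c, fun hPc ↦ hempty.false (hP _ hPc).some⟩

section T2

variable {Y : Type} [TopologicalSpace Y] [ChartedSpace E3 Y] [IsManifold (𝓡 3) ∞ Y] [ConnectedSpace Y]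

/-- **On a non-Hausdorff `Σ` carrying an admissible datum, no property that needs a development is
tame-generic**: no datum on `Σ` has a vacuum Cauchy development (a data embedding lands in a Hausdorff
spacetime, `isEmpty_vacuumCauchyDevelopment_of_not_t2Space`), so every admissible datum is exceptional
and the members of a would-be witness curve, being admissible, are exceptional too. Hence `[T2Space Σ]`
is load-bearing for H′ — degenerately: modulo ONE such `Σ` (e.g. `ℝ³` with a doubled origin and the
flat data, not constructed in the tree) the `T2`-free crux is false. [cite: ChoquetBruhatGeroch1969CMP, p. 330] -/
theorem not_isTameGeneric_of_not_t2Space (hY : ¬ T2Space Y) {d : InitialDataSet (𝓡 3) Y}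
    (hd : d ∈ admissibleVacuumData Y) {P : InitialDataSet (𝓡 3) Y → Prop}
    (hP : ∀ D, P D → Nonempty (VacuumCauchyDevelopment D)) :
    ¬ IsTameChristodoulouGeneric (admissibleVacuumData Y) P 1 :=
  not_isTameGeneric_of_forall_not P hd fun D _ hPD ↦
    (isEmpty_vacuumCauchyDevelopment_of_not_t2Space hY D).false (hP D hPD).some

end T2

/-- **With `IsMaximal` dropped from the `∀`-clause the trivial datum is exceptional, whatever else is
demanded of the developments**: the time-truncated Minkowski space `{x⁰ < 1}` is a vacuum Cauchy
development of `(ℝ³, δ, 0)` with INCOMPLETE `𝓘⁺` in the sojourn form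
(`WeakCosmicCensorshipMGHD/Negative/TruncatedMinkowski.lean`). For H′ take `Q 𝒟` = "the sixteen-clause
ansatz with handoff for some `N`". [cite: Christodoulou1999, p. A27] -/
theorem trivialData_exceptional_forallDev (Q : VacuumCauchyDevelopment trivialData → Prop) :
    ¬ ((∃ 𝒟 : VacuumCauchyDevelopment trivialData, 𝒟.IsMaximal) ∧
        ∀ 𝒟 : VacuumCauchyDevelopment trivialData,
          _root_.Summit.FinalStateConjecture.HasCompleteNullInfinity 𝒟.toCauchyDevelopment ∧ Q 𝒟) := by
  rintro ⟨-, hall⟩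
  obtain ⟨𝒟, h𝒟⟩ := exists_vacuumCauchyDevelopment_trivialData_not_complete
  exact h𝒟 (hall 𝒟).1

/-- **`IsMaximal` in the `∀`-clause is load-bearing for every refinement of censorship**: modulo the
(true, here unconstructed) fact that every admissible datum on `ℝ³` has SOME vacuum Cauchy development
with incomplete future null infinity — local existence (Choquet-Bruhat 1952) followed by truncation in
a Cauchy time function — the property "an MGHD exists ∧ EVERY development has complete `𝓘⁺` ∧ `Q`" is
not tame-generic in `admissibleVacuumData ℝ³`, for every post-development demand `Q` (for H′: the
sixteen-clause ansatz with handoff): every admissible datum is exceptional and the class is inhabited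
by `trivialData`. [cite: ChoquetBruhatGeroch1969CMP, p. 330] -/
theorem not_isTameGeneric_forallDev_of
    (H : ∀ D ∈ admissibleVacuumData Minkowski.slice, ∃ 𝒟 : VacuumCauchyDevelopment D,
      ¬ _root_.Summit.FinalStateConjecture.HasCompleteNullInfinity 𝒟.toCauchyDevelopment)
    (Q : ∀ D : InitialDataSet (𝓡 3) Minkowski.slice, VacuumCauchyDevelopment D → Prop) :
    ¬ IsTameChristodoulouGeneric (admissibleVacuumData Minkowski.slice)
      (fun D ↦ (∃ 𝒟 : VacuumCauchyDevelopment D, 𝒟.IsMaximal) ∧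
        ∀ 𝒟 : VacuumCauchyDevelopment D,
          _root_.Summit.FinalStateConjecture.HasCompleteNullInfinity 𝒟.toCauchyDevelopment ∧ Q D 𝒟) 1 := by
  refine not_isTameGeneric_of_forall_not _ trivialData_mem_admissibleVacuumData fun D hD ⟨_, hall⟩ ↦ ?_
  obtain ⟨𝒟, h𝒟⟩ := H D hD
  exact h𝒟 (hall 𝒟).1

/-! ## §2 By name: H′ refines tame censorship, and what a pointwise refutation of H′ needs -/

/-- **THE CRUX IMPLIES TAME TYPED WEAK COSMIC CENSORSHIP, `Σ` by `Σ`** (the property of H′ refines the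
censored property pointwise; tame genericity is monotone in the property): a refutation of the
censorship content of the summit — an admissible datum with incomplete `𝓘⁺` in some MGHD, trapping
every tame curve — kills H′; conversely nothing weaker than tame-generic censorship + MGHD existence can
prove it. The conclusion is verbatim the body of the sibling crux `WeakCosmicCensorshipTame` (17269).
[cite: Christodoulou1999, p. A27] -/
theorem isTameGeneric_censored_of_modulatedKerrHandoff (h : ModulatedKerrHandoff) (X : Type)
    [TopologicalSpace X] [ChartedSpace E3 X] [IsManifold (𝓡 3) ∞ X] [T2Space X]
    [SecondCountableTopology X] [ConnectedSpace X] :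
    IsTameChristodoulouGeneric (admissibleVacuumData X)
      (fun D ↦ (∃ 𝒟 : VacuumCauchyDevelopment D, 𝒟.IsMaximal) ∧
        ∀ 𝒟 : VacuumCauchyDevelopment D, 𝒟.IsMaximal →
          _root_.Summit.FinalStateConjecture.HasCompleteNullInfinity 𝒟.toCauchyDevelopment) 1 :=
  (h X).mono fun _ _ hP ↦ ⟨hP.1, fun 𝒟 h𝒟 ↦ (hP.2 𝒟 h𝒟).1⟩

/-- **ROAD 1 TO A POINTWISE KILL: censorship failing at EVERY admissible datum on `ℝ³`** (in some MGHD,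
or for want of an MGHD) refutes H′ — the admissible class of `ℝ³` is inhabited by `trivialData`, and
every member of a would-be witness curve is admissible, hence exceptional. (Closed at the model point:
the Minkowski development of the trivial datum HAS complete `𝓘⁺`, `minkowski_hasCompleteNullInfinity`;
its maximality is the missing Choquet-Bruhat–Geroch/uniqueness fact.) [cite: Christodoulou1999, p. A27] -/
theorem not_modulatedKerrHandoff_of_forall_not_censored
    (h : ∀ D ∈ admissibleVacuumData Minkowski.slice,
      ¬ ((∃ 𝒟 : VacuumCauchyDevelopment D, 𝒟.IsMaximal) ∧
          ∀ 𝒟 : VacuumCauchyDevelopment D, 𝒟.IsMaximal →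
            _root_.Summit.FinalStateConjecture.HasCompleteNullInfinity 𝒟.toCauchyDevelopment)) :
    ¬ ModulatedKerrHandoff := fun hH ↦
  not_isTameGeneric_of_forall_not _ trivialData_mem_admissibleVacuumData h
    (isTameGeneric_censored_of_modulatedKerrHandoff hH Minkowski.slice)

/-- **ROAD 2 TO A POINTWISE KILL: MGHD non-existence.** If NO admissible datum on `ℝ³` had a maximal
vacuum Cauchy development, H′ would be false. (True MGHD existence, Choquet-Bruhat–Geroch, closes this
road in reality; in the tree it is the undischarged named fact `choquetBruhat_geroch_exists_mghd_cauchy`,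
so the road is closed only modulo that fact — and conversely H′ cannot be PROVED without an instance
of it, `exists_isMaximal_of_modulatedKerrHandoff`.) [cite: ChoquetBruhatGeroch1969CMP, p. 330] -/
theorem not_modulatedKerrHandoff_of_forall_not_isMaximal
    (h : ∀ D ∈ admissibleVacuumData Minkowski.slice, ∀ 𝒟 : VacuumCauchyDevelopment D, ¬ 𝒟.IsMaximal) :
    ¬ ModulatedKerrHandoff :=
  not_modulatedKerrHandoff_of_forall_not_censored fun D hD ⟨⟨𝒟, h𝒟⟩, _⟩ ↦ h D hD 𝒟 h𝒟

/-- **EXISTENTIAL CONTENT: H′ produces a maximal vacuum Cauchy development of an admissible datum on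
`ℝ³` with complete `𝓘⁺`** (tame codimension `1` on the nonempty admissible class of `ℝ³` yields a
GOOD datum: the trivial datum itself, or any member off `0` of the witness curve through it). MGHD
theory AND censorship are load-bearing; no proof of H′ by bookkeeping. [cite: ChoquetBruhatGeroch1969CMP, p. 330] -/
theorem exists_isMaximal_of_modulatedKerrHandoff (h : ModulatedKerrHandoff) :
    ∃ D ∈ admissibleVacuumData Minkowski.slice, ∃ 𝒟 : VacuumCauchyDevelopment D, 𝒟.IsMaximal ∧
      _root_.Summit.FinalStateConjecture.HasCompleteNullInfinity 𝒟.toCauchyDevelopment := by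
  by_contra hcon
  push Not at hcon
  refine not_modulatedKerrHandoff_of_forall_not_censored (fun D hD ⟨⟨𝒟, h𝒟⟩, hall⟩ ↦ ?_) h
  exact hcon D hD 𝒟 h𝒟 (hall 𝒟 h𝒟)

/-! ## §3 The witness notion: receding-only modifications are not immersed -/

section Immersion

variable {E : Type*} [NormedAddCommGroup E] [NormedSpace ℝ E] {H : Type*} [TopologicalSpace H]
  {I : ModelWithCorners ℝ E H} {X : Type*} [TopologicalSpace X] [ChartedSpace H X]
  [IsManifold I ∞ X]

/-- **RECEDING-ONLY MODIFICATIONS ARE NOT IMMERSED.** If along the family `F : ℝᵐ → data`, `m ≠ 0`,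
every scalar component `c ↦ h_c(x)(u, w)`, `c ↦ k_c(x)(u, w)` at every point agrees with its value at
`c = 0` for all parameters `c` near `0` (the neighbourhood may depend on the point — the signature of a
family that modifies the base datum only on a set RECEDING to infinity as `c → 0`: tail trimming /
Kerr-end gluing at radius `R(c) → ∞`, far-out pulses), then `F` is not immersed at `0`
(`IsImmersedAtZero`): all its parameter derivatives at `0` vanish. Under the TAME re-typing every
witness curve of H′ must therefore move the base datum at first order at some point at `c = 0`; pure
far-field surgery — which swallowed the tail strata of the retired crux 10167 (slow admissible tails
`r^{-1-ε}`, `ε < 3/4`, violate the `m = 0` cone weight `d^{7/4}` in every MGHD) — is no longer a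
witness by itself and must be composed with a compactly supported first-order direction.
[cite: Christodoulou1999, p. A24] -/
theorem not_isImmersedAtZero_of_eventuallyEq {m : ℕ} (hm : m ≠ 0)
    {F : EuclideanSpace ℝ (Fin m) → InitialDataSet I X}
    (hh : ∀ (x : X) (u w : TangentSpace I x),
      (fun c ↦ (F c).h.inner x u w) =ᶠ[𝓝 0] fun _ ↦ (F 0).h.inner x u w)
    (hk : ∀ (x : X) (u w : TangentSpace I x),
      (fun c ↦ (F c).k x u w) =ᶠ[𝓝 0] fun _ ↦ (F 0).k x u w) :
    ¬ IsImmersedAtZero m F := by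
  intro himm
  obtain ⟨x, u, w, huw⟩ :=
    himm (EuclideanSpace.single ⟨0, Nat.pos_of_ne_zero hm⟩ 1) (by simp)
  have h1 : fderiv ℝ (fun c ↦ (F c).h.inner x u w) 0 = 0 := by
    rw [(hh x u w).fderiv_eq]; exact fderiv_const_apply _
  have h2 : fderiv ℝ (fun c ↦ (F c).k x u w) 0 = 0 := by
    rw [(hk x u w).fderiv_eq]; exact fderiv_const_apply _
  rcases huw with h | h
  · exact h (by rw [h1]; rfl)
  · exact h (by rw [h2]; rfl)

end Immersion

end Summit.FinalStateConjecture.FinalStateConjecture.Theorems.ModulatedKerrHandoff.Negative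

end
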